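import Summits.QuantumAdvantage.QuantumAdvantage.Theorems.LinnikCubicClassGroupsDegreeOnePrimesEscapeResidueAnalysis
import Literature.NumberTheory.LFunctions.StarkExceptionalZeroProofs
import Literature.NumberTheory.LFunctions.IdealNormCount
import Literature.NumberTheory.LFunctions.SiegelTheoremAbstract
import HarnessLib

/-!
# Elementary inputs for Stark's residue bound: `Re ζ_K(σ) ≥ 1`, `‖ζ₁_K(σ)‖ ≥ σ − 1`, and the gamma
# factor at `σ ∈ [1,2]` against the gamma factor at `1`

Topic `Summits/QuantumAdvantage/QuantumAdvantage/Theorems`, helper for the crux `DegreeOnePrimesEscape`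
(stmt-QuantumAdvantage-11543) of route `LinnikCubicClassGroups`; cell B2b-1 (linnik-cubic), PART B (the
residue lower bound R, [Stark1974, Lemma 4]). HONEST FRAMING: the value of this file is a THEOREM — not
summit progress.

* `one_le_re_dedekindZeta`, `sub_one_le_norm_dedekindZeta₁` — the trivial lower bounds on the real axis;
* `norm_dedekindGammaFactor_ge` — `‖γ_K(σ)‖ ≥ 16^{−n} ‖γ_K(1)‖` for `1 ≤ σ ≤ 2`
  (`γ_K = |d_K|^{s/2} Γ_ℝ^{r₁} Γ_ℂ^{r₂}`, `dedekindGammaFactor`);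
* `exp_neg_seven_le` — the numerical constant `e^{−7} ≤ (3/10) e^{−9/2}`.
-/

noncomputable section

open Complex Filter Topology Set NumberField NumberField.InfinitePlace
open scoped ComplexOrder

namespace Summit.QuantumAdvantage.QuantumAdvantage.Theorems.DegreeOnePrimesEscape

namespace Residue

open Literature.NumberTheory.LFunctions Literature.NumberTheory.LFunctions.NumberField
  Literature.NumberTheory.LFunctions.Stark1974

/-! ### Elementary inputs -/

/-- `Re ζ_K(σ) ≥ 1` for real `σ > 1` (the term `𝔞 = 𝒪_K` of the Dirichlet series). [folklore] -/
theorem one_le_re_dedekindZeta (K : Type) [Field K] [NumberField K] {σ : ℝ} (hσ : 1 < σ) :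
    1 ≤ (NumberField.dedekindZeta K σ).re := by
  rw [dedekindZeta_eq_LSeries]
  refine one_le_re_LSeries_ofReal (fun n => ?_) (by simp [idealNormCount_one]) ?_
  · exact Nat.cast_nonneg _
  · exact LSeriesSummable_dedekindZeta (by simpa using hσ)

/-- `‖ζ₁_K(σ)‖ ≥ σ − 1` for real `σ > 1`. [folklore] -/
theorem sub_one_le_norm_dedekindZeta₁ (K : Type) [Field K] [NumberField K] {σ : ℝ} (hσ : 1 < σ) :
    σ - 1 ≤ ‖dedekindZeta₁ K σ‖ := by
  have h := one_le_re_dedekindZeta K hσ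
  have hre : (dedekindZeta₁ K σ).re = (σ - 1) * (NumberField.dedekindZeta K σ).re := by
    rw [dedekindZeta₁_apply_eq_mul (by simpa using hσ), show (σ : ℂ) - 1 = ((σ - 1 : ℝ) : ℂ) by
      push_cast; ring, Complex.re_ofReal_mul]
  calc σ - 1 ≤ (σ - 1) * (NumberField.dedekindZeta K σ).re := by nlinarith
    _ = (dedekindZeta₁ K σ).re := hre.symm
    _ ≤ ‖dedekindZeta₁ K σ‖ := Complex.re_le_norm _

set_option maxHeartbeats 400000 in
/-- **The gamma factor at `σ ∈ [1,2]` against the gamma factor at `1`**: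
`‖γ_K(σ)‖ ≥ 16^{−n} ‖γ_K(1)‖` (`|d_K|^{σ/2} ≥ |d_K|^{1/2}`, `‖Γ_ℝ(σ)‖ ≥ 1/16 = ‖Γ_ℝ(1)‖/16`,
`‖Γ_ℂ(σ)‖ ≥ ‖Γ_ℂ(1)‖/16`, `r₁ + r₂ ≤ n`). [folklore] -/
theorem norm_dedekindGammaFactor_ge (K : Type) [Field K] [NumberField K] {σ : ℝ} (h1 : 1 ≤ σ)
    (h2 : σ ≤ 2) :
    (1 / 16 : ℝ) ^ Module.finrank ℚ K * ‖dedekindGammaFactor K 1‖ ≤ ‖dedekindGammaFactor K σ‖ := by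
  set d : ℝ := ((discr K).natAbs : ℝ) with hd
  have hd1 : (1 : ℝ) ≤ d := by
    rw [hd]; exact_mod_cast Nat.one_le_iff_ne_zero.mpr (Int.natAbs_ne_zero.mpr (discr_ne_zero K))
  have hd0 : 0 < d := by linarith
  have hdC : ((discr K).natAbs : ℂ) = ((d : ℝ) : ℂ) := by rw [hd]; push_cast; rfl
  unfold dedekindGammaFactor
  rw [norm_mul, norm_mul, norm_pow, norm_pow, norm_mul, norm_mul, norm_pow, norm_pow, hdC,
    Complex.norm_cpow_eq_rpow_re_of_pos hd0, Complex.norm_cpow_eq_rpow_re_of_pos hd0, Gammaℝ_one,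
    norm_one, one_pow, mul_one]
  have hre1 : ((1 : ℂ) / 2).re = 1 / 2 := by simp
  have hreσ : ((σ : ℂ) / 2).re = σ / 2 := by simp
  rw [hre1, hreσ]
  -- the pieces
  have hdpow : d ^ ((1 : ℝ) / 2) ≤ d ^ (σ / 2) := Real.rpow_le_rpow_of_exponent_le hd1 (by linarith)
  have hR : (1 / 16 : ℝ) ^ nrRealPlaces K ≤ ‖Gammaℝ (σ : ℂ)‖ ^ nrRealPlaces K :=
    pow_le_pow_left₀ (by norm_num) (norm_Gammaℝ_ge h1 h2) _
  have hC : ((1 / 16 : ℝ) * ‖Gammaℂ (1 : ℂ)‖) ^ nrComplexPlaces K ≤ ‖Gammaℂ (σ : ℂ)‖ ^ nrComplexPlaces K :=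
    pow_le_pow_left₀ (by positivity) (norm_Gammaℂ_ge h1 h2) _
  have hn : nrRealPlaces K + 2 * nrComplexPlaces K = Module.finrank ℚ K := card_add_two_mul_card_eq_rank K
  have hpow : (1 / 16 : ℝ) ^ Module.finrank ℚ K ≤ (1 / 16 : ℝ) ^ (nrRealPlaces K + nrComplexPlaces K) :=
    pow_le_pow_of_le_one (by norm_num) (by norm_num) (by omega)
  have hd12 : 0 ≤ d ^ ((1 : ℝ) / 2) := Real.rpow_nonneg hd0.le _
  have hG1 : 0 ≤ ‖Gammaℂ (1 : ℂ)‖ := norm_nonneg _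
  calc (1 / 16 : ℝ) ^ Module.finrank ℚ K * (d ^ ((1 : ℝ) / 2) * ‖Gammaℂ (1 : ℂ)‖ ^ nrComplexPlaces K)
      ≤ (1 / 16 : ℝ) ^ (nrRealPlaces K + nrComplexPlaces K) *
          (d ^ ((1 : ℝ) / 2) * ‖Gammaℂ (1 : ℂ)‖ ^ nrComplexPlaces K) :=
        mul_le_mul_of_nonneg_right hpow (by positivity)
    _ = d ^ ((1 : ℝ) / 2) * (1 / 16 : ℝ) ^ nrRealPlaces K *
          ((1 / 16 : ℝ) * ‖Gammaℂ (1 : ℂ)‖) ^ nrComplexPlaces K := by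
        rw [pow_add, mul_pow]; ring
    _ ≤ d ^ (σ / 2) * ‖Gammaℝ (σ : ℂ)‖ ^ nrRealPlaces K * ‖Gammaℂ (σ : ℂ)‖ ^ nrComplexPlaces K := by
        have hA0 : (0 : ℝ) ≤ (1 / 16 : ℝ) ^ nrRealPlaces K := pow_nonneg (by norm_num) _
        have hB0 : (0 : ℝ) ≤ ((1 / 16 : ℝ) * ‖Gammaℂ (1 : ℂ)‖) ^ nrComplexPlaces K :=
          pow_nonneg (by positivity) _
        have hσ0 : (0 : ℝ) ≤ d ^ (σ / 2) := Real.rpow_nonneg hd0.le _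
        have h1 : d ^ ((1 : ℝ) / 2) * (1 / 16 : ℝ) ^ nrRealPlaces K ≤
            d ^ (σ / 2) * ‖Gammaℝ (σ : ℂ)‖ ^ nrRealPlaces K :=
          mul_le_mul hdpow hR hA0 hσ0
        have h2 : (0 : ℝ) ≤ d ^ (σ / 2) * ‖Gammaℝ (σ : ℂ)‖ ^ nrRealPlaces K :=
          mul_nonneg hσ0 (pow_nonneg (norm_nonneg _) _)
        exact mul_le_mul h1 hC hB0 h2

/-- `e^{−7} ≤ (3/10) e^{−9/2}` (`e^{5/2} ≥ 1 + 5/2`). [folklore] -/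
theorem exp_neg_seven_le : Real.exp (-7) ≤ 3 / 10 * Real.exp (-9 / 2) := by
  have h : Real.exp (-7) = Real.exp (-9 / 2) * Real.exp (-(5 / 2)) := by
    rw [← Real.exp_add]; norm_num
  have h52 : (1 : ℝ) + 5 / 2 ≤ Real.exp (5 / 2) := by
    have := Real.add_one_le_exp (5 / 2 : ℝ); linarith
  have hinv : Real.exp (-(5 / 2 : ℝ)) ≤ 3 / 10 := by
    rw [Real.exp_neg, inv_le_comm₀ (Real.exp_pos _) (by norm_num)]
    linarith
  rw [h]
  nlinarith [Real.exp_pos (-9 / 2 : ℝ)]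

end Residue

end Summit.QuantumAdvantage.QuantumAdvantage.Theorems.DegreeOnePrimesEscape

end
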